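import Summits.BirchSwinnertonDyer.BirchSwinnertonDyer.Theses.KolyvaginRankRigidityAtTwo
import Summits.BirchSwinnertonDyer.BirchSwinnertonDyer.Theorems.KolyvaginRankRigidityAtTwoFullClassDeepeningAtTwoOfProp37
import Summits.BirchSwinnertonDyer.BirchSwinnertonDyer.Theorems.KolyvaginRankRigidityAtTwoOffHabitatIrredSwapOfNamedFacts
import Summits.BirchSwinnertonDyer.BirchSwinnertonDyer.Theorems.KolyvaginRankRigidityAtTwoOffHabitatIrredLevelLinks
import Summits.BirchSwinnertonDyer.BirchSwinnertonDyer.Theorems.KolyvaginRankRigidityAtTwoOffHabitatIrredWindowPrime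
import HarnessLib

/-!
# Route `KolyvaginRankRigidityAtTwo`, residual crux R_irr `OffHabitatIrredNonSurjTwoConverse`
# (stmt-BirchSwinnertonDyer-27123), LINE 8∞ `kolyvagin_depth_split_inf_irr`: U2irr `FullClassDeepeningAtTwoIrr`
# (the TRANSPORT half of V1irr, one level below the registered stub `stub_strongNonzeroSystemAtTwoIrr`) OFF THE
# HABITAT, modulo TWO NAMED PRINT FACTS (Gross 1991 Prop. 3.7 (2); Serre's open image theorem)
# (width seat krr2-p2 g10; helper, `--supports` 27123)

`fullClassDeepeningAtTwoIrr_of_prop37 (h37) (hSerre)`: the TEXT of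
`Cruxes.OffHabitatIrredNonSurjTwoConverse.KolyvaginDepthSplitInfIrr.FullClassDeepeningAtTwoIrr` (U2irr = U2
`FullClassDeepeningAtTwo`, 28084, on R_irr's frame `E(ℚ)[2] = 0`, `2`-adic image of finite index), VERBATIM (a
Theorems file cannot import the Cruxes line file): on the Heegner frame there is a constant `c` such that every NEARLY
FULL Kolyvagin class `2^{M−m−1} c_M(n) ≠ 0` (depth `r`, `M ≤ M(n)`, `c (m + r + 1) ≤ M`) can be moved to a conductor
`n′` of the SAME depth all of whose primes have index `≥ θ M′ + k`, for ANY `(θ, k)`, with `c_{M′}(n′) ≠ 0`.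
It is the habitat `fullClassDeepeningAtTwo_of_prop37` (p642176) RE-THREADED: one level down ↦
`globalOrderLevelDownAtTwo_offHabitat` (p654589), S1L ↦ `primeSwapAtTwoLossy_offHabitat_of_namedFacts h37 hSerre`
(krr2-p2 g10), CHEB = S2 ↦ `chebotarevOneClassIndexAtTwo_offHabitat hSerre` (p655785); the seed walk
`seedTransport_of_lossySwap` is image-free and reused as landed. Constant `c = c₀ + 2 c₁ + 2 c₂ + 4`. No new mathematics.
Also the U-split glue off habitat `strongNonzeroSystemAtTwoIrr_of_boundedDefectIrr` (U1irr displayed ⟹ V1irr, twin of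
LINE 14's glue p641290): the line's open content after this file is exactly U1irr + the two print facts.
HONEST FRAMING: CONDITIONAL on the named print facts `GrossLMS1991.prop37_2_frobeniusCongruence` and
`serre_adicImage_contains_congruenceSubgroup` (conditional-result); U1irr `BoundedDefectAtTwoIrr` (Kolyvagin's
Conjecture A at `2` with bounded defect, off habitat) — the organ of V1irr — stays OPEN; R_irr is NOT closed; the
Birch–Swinnerton-Dyer conjecture is NOT proved by any of this.
References: [cite: Kolyvagin1991MathAnn, §2 (proof of Thm. 2.2), p. 257] [cite: McCallumLMS1991, §5 Prop. 5.2, §4 (4)–(6)]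
[cite: WZhang2014, Lemma 8.4] [cite: GrossLMS1991, Prop. 3.7 (2)] [cite: SilvermanAEC2009, Thm. III.7.9 (a)].
-/

set_option autoImplicit false
-- the Theorems namespace of this sub repeats the summit name by design (D-0017 nested layout)
set_option linter.dupNamespace false

noncomputable section

open scoped Classical

open WeierstrassCurve Field Literature.NumberTheory.EllipticCurves Literature.NumberTheory.EllipticCurves.KolyvaginCocycle
  Literature.NumberTheory.EllipticCurves.ModularForms NumberField IsDedekindDomain
open Summit.BirchSwinnertonDyer.BirchSwinnertonDyer.Theses.KolyvaginRankRigidityAtTwo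
open Literature.NumberTheory.EllipticCurves.GrossLMS1991 (prop37_2_frobeniusCongruence)

namespace Summit.BirchSwinnertonDyer.BirchSwinnertonDyer.Theorems.KolyvaginLowerBoundAtTwo

/-- **U2irr `FullClassDeepeningAtTwoIrr` (its text VERBATIM) from Gross 1991 Prop. 3.7 (2) (`h37`) and Serre's open
image theorem (`hSerre`)**: the transport of a nearly full class to a conductor of the same depth and arbitrary
relative margin on R_irr's frame, by one level down (off habitat), CHEB (S2 off habitat), the seed walk with the
off-habitat lossy swap S1L, and the target index `I = θ M′ + k + M′ + 1`; constant `c = c₀ + 2 c₁ + 2 c₂ + 4`.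
CONDITIONAL on the two named print facts; the hypothesis `¬ (∀ m, ρ_{E,2^m} onto)` is not used. BSD is not proved
by this. [cite: Kolyvagin1991MathAnn, §2 (proof of Thm. 2.2), p. 257] [cite: McCallumLMS1991, §5 Prop. 5.2]
[cite: GrossLMS1991, Prop. 3.7 (2)] [cite: SilvermanAEC2009, Thm. III.7.9 (a)] -/
theorem fullClassDeepeningAtTwoIrr_of_prop37 (h37 : prop37_2_frobeniusCongruence)
    (hSerre : serre_adicImage_contains_congruenceSubgroup) :
    ∀ (W : WeierstrassCurve ℚ) [W.IsElliptic] [W.IsGloballyMinimal], ¬ W.HasCM → (Literature.NumberTheory.EllipticCurves.Rank1Residual.GoodOrd W 2 ∨ Literature.NumberTheory.EllipticCurves.Rank1Residual.Mult W 2) → ¬ (∀ m : ℕ, W.HasSurjectiveModNGaloisRep (2 ^ m : ℕ)) → AddSubgroup.torsionBy W.toAffine.Point (2 : ℤ) = ⊥ → ∀ (K : Type) [Field K] [NumberField K], Literature.NumberTheory.EllipticCurves.IsImaginaryQuadratic K → ∀ [NeZero (W.conductorNorm ℤ)], Literature.NumberTheory.EllipticCurves.SatisfiesHeegnerHypothesis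 (W.conductorNorm ℤ) K → Odd (NumberField.discr K) → NumberField.discr K ≠ -3 → AddSubgroup.torsionBy (W.baseChange K).toAffine.Point (2 : ℤ) = ⊥ → Literature.NumberTheory.EllipticCurves.SatisfiesHeegnerHypothesis 2 K → ∀ (Dt : Literature.NumberTheory.EllipticCurves.ModularForms.ModularParametrizationData W (W.conductorNorm ℤ)) (β : ℤ) (ι : K →+* ℂ), (4 * (W.conductorNorm ℤ : ℤ)) ∣ β ^ 2 - NumberField.discr K → ∃ c : ℕ, ∀ (θ k r m M n : ℕ) (d : Literature.NumberTheory.EllipticCurves.KolyvaginHeegnerData Dt β ι n), Literature.NumberTheory.EllipticCurves.KolyvaginDescent.KolSupp (Literature.NumberTheory.EllipticCurves.Zhang2014.IsKolyvaginPrime (W.conductorNorm ℤ) W K 2) n → n.primeFactors.card = r → ((M : ℕ) : ℕ∞) ≤ Literature.NumberTheory.EllipticCurves.Zhang2014.levelIndex W 2 n → c * (m + r + 1) ≤ M → (2 ^ (M - m - 1) : ℤ) • d.kolyvaginClass Nat.prime_two M ≠ 0 → ∃ (n' : ℕ) (d' : Literature.NumberTheory.EllipticCurves.KolyvaginHeegnerData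 Dt β ι n') (M' : ℕ), Literature.NumberTheory.EllipticCurves.KolyvaginDescent.KolSupp (Literature.NumberTheory.EllipticCurves.Zhang2014.IsKolyvaginPrime (W.conductorNorm ℤ) W K 2) n' ∧ n'.primeFactors.card = r ∧ 1 ≤ M' ∧ ((θ * M' + k : ℕ) : ℕ∞) ≤ Literature.NumberTheory.EllipticCurves.Zhang2014.levelIndex W 2 n' ∧ d'.kolyvaginClass Nat.prime_two M' ≠ 0 := by
  intro W _ _ hCM hred _hns htorQ K _ _ hK _ hHN hodd hne3 _ _ Dt β ι _
  classical
  haveI : Fact (Nat.Prime 2) := ⟨Nat.prime_two⟩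
  set N := W.conductorNorm ℤ with hNdef
  have hne4 : NumberField.discr K ≠ -4 := fun h ↦ by
    rw [h] at hodd; exact (Int.not_even_iff_odd.mpr hodd) ⟨-2, by norm_num⟩
  have h2d : ¬ ((2 : ℤ) ∣ NumberField.discr K) := fun h ↦
    (Int.not_even_iff_odd.mpr hodd) (even_iff_two_dvd.mpr h)
  obtain ⟨c₀, c₂, hS1⟩ :=
    primeSwapAtTwoLossy_offHabitat_of_namedFacts h37 hSerre W hCM hred htorQ K hK hne3 hne4 h2d hHN
  obtain ⟨c₁, hS2⟩ := chebotarevOneClassIndexAtTwo_offHabitat hSerre W hCM hred htorQ K hK hne3 hne4 h2d hHN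
  refine ⟨c₀ + 2 * c₁ + 2 * c₂ + 4, ?_⟩
  intro θ k r m M n d hn hr hlev hcM hne
  -- arithmetic of the constant
  have hcm : 2 * m ≤ (c₀ + 2 * c₁ + 2 * c₂ + 4) * m := Nat.mul_le_mul_right m (by omega)
  have hcr : 2 * c₂ * r ≤ (c₀ + 2 * c₁ + 2 * c₂ + 4) * r := Nat.mul_le_mul_right r (by omega)
  have hcr' : 2 * (c₂ * r) ≤ (c₀ + 2 * c₁ + 2 * c₂ + 4) * r := by rw [← mul_assoc]; exact hcr
  have hsplit : (c₀ + 2 * c₁ + 2 * c₂ + 4) * (m + r + 1) =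
      (c₀ + 2 * c₁ + 2 * c₂ + 4) * m + (c₀ + 2 * c₁ + 2 * c₂ + 4) * r + (c₀ + 2 * c₁ + 2 * c₂ + 4) := by ring
  have hM : 2 * m + 2 * (c₂ * r) + c₀ + 2 * c₁ + 4 ≤ M := by
    rw [hsplit] at hcM; omega
  -- the working level `M' = M - 1` (margin one at the primes of `n`)
  obtain ⟨Mw, rfl⟩ : ∃ Mw, M = Mw + 1 := ⟨M - 1, by omega⟩
  have hMw1 : 1 ≤ Mw := by omega
  have hlevMw : ((Mw : ℕ) : ℕ∞) ≤ Zhang2014.levelIndex W 2 n :=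
    le_trans (by exact_mod_cast Nat.le_succ Mw) hlev
  have hidx : ∀ p ∈ n.primeFactors, Zhang2014.IsKolyvaginPrime N W K 2 p ∧ Mw + 1 ≤ Zhang2014.kolyvaginIndex W 2 p :=
    fun p hp ↦ ⟨hn.2 p hp, (Zhang2014.natCast_le_levelIndex_iff.mp hlev) p hp⟩
  -- one level down (off habitat): `2^{Mw - m - 1} c_{Mw}(n) ≠ 0`
  have hdown : ((2 ^ (Mw - m - 1) : ℕ) : ℤ) • d.kolyvaginClass Nat.prime_two Mw ≠ 0 := by
    refine globalOrderLevelDownAtTwo_offHabitat W htorQ K hK hne3 hne4 hHN Dt β ι n d Mw (Mw - m - 1) hn hlev ?_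
    rw [show Mw - m - 1 + 1 = Mw + 1 - m - 1 by omega]
    exact hne
  -- CHEB (S2 off habitat): the class is BIG at exponent `j₀ = Mw - m - 1 - c₁` at fresh primes of index `≥ I`
  set I : ℕ := θ * Mw + k + Mw + 1 with hI
  have hIMw : Mw + 1 ≤ I := by omega
  have hBig := hS2 Dt β ι n d Mw (Mw - m - 1) I hn hMw1 hlevMw (by omega) (by omega) hdown
  -- the seed walk on `T₀ = primeFactors n` (image-free, landed)
  set T₀ : Finset ℕ := n.primeFactors with hT₀
  have hprod₀ : ∏ p ∈ T₀, p = n := Nat.prod_primeFactors_of_squarefree hn.1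
  let d₀ : KolyvaginHeegnerData Dt β ι (∏ p ∈ T₀, p) := hprod₀.symm ▸ d
  have hcl : ∀ M' : ℕ, d₀.kolyvaginClass Nat.prime_two M' = d.kolyvaginClass Nat.prime_two M' := by
    intro M'
    change (hprod₀.symm ▸ d).kolyvaginClass Nat.prime_two M' = _
    exact kolyvaginClass_cast_swap hprod₀.symm d M'
  have hrel : Mw + c₀ ≤ 2 * (Mw - m - 1 - c₁ - T₀.card * c₂) := by
    rw [hT₀, hr, mul_comm r c₂]; omega
  obtain ⟨T', dat', hcard', hKol', hBig'⟩ := seedTransport_of_lossySwap W Dt β ι c₀ c₂ (hS1 Dt β ι) hMw1 hIMw T₀ d₀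
    hidx hrel (fun X' ↦ by
      obtain ⟨q, hqX, hqKol, hqI, v, hv, hloc⟩ := hBig X'
      exact ⟨q, hqX, hqKol, hqI, v, hv, by rw [hcl]; exact hloc⟩)
  -- reading off: `n' = ∏ T'`, `M' = Mw`
  have hT'prime : ∀ p ∈ T', p.Prime := fun p hp ↦ (hKol' p hp).1.1
  have hpf : (∏ p ∈ T', p).primeFactors = T' := Nat.primeFactors_prod hT'prime
  have hsupp : KolyvaginDescent.KolSupp (Zhang2014.IsKolyvaginPrime N W K 2) (∏ p ∈ T', p) :=
    ⟨Literature.NumberTheory.Sieve.FriedlanderIwaniecPrimesSquarefree.squarefree_prod_of_primes hT'prime,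
      fun p hp ↦ (hKol' p (by rwa [hpf] at hp)).1⟩
  obtain ⟨q, -, -, -, v, -, hloc⟩ := hBig' ∅
  refine ⟨∏ p ∈ T', p, dat', Mw, hsupp, by rw [hpf, hcard', hT₀, hr], hMw1, ?_, fun h0 ↦ hloc ?_⟩
  · rw [Zhang2014.natCast_le_levelIndex_iff]
    intro p hp
    rw [hpf] at hp
    have := (hKol' p hp).2
    omega
  · rw [h0, zsmul_zero]
    exact zero_mem _

/-- **Glue of the U-split of V1irr, off the habitat** (twin of LINE 14's `strongNonzeroSystemOfSeedTransport_proof`):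
U1irr `BoundedDefectAtTwoIrr` (Kolyvagin's Conjecture A at `2` with bounded defect on R_irr's frame — the OPEN organ,
taken as the displayed hypothesis `hU1`, its text VERBATIM) together with U2irr (`fullClassDeepeningAtTwoIrr_of_prop37`)
gives V1irr `StrongNonzeroSystemAtTwoIrr` (text of the registered stub `stub_strongNonzeroSystemAtTwoIrr`, VERBATIM):
choose the level `M := c·(m+r+1)+m+1`. CONDITIONAL on `hU1` (open) and the two named print facts; this does NOT prove
V1irr — it records that the line's open content is exactly U1irr + print. BSD is not proved by this. [folklore] -/
theorem strongNonzeroSystemAtTwoIrr_of_boundedDefectIrr (h37 : prop37_2_frobeniusCongruence)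
    (hSerre : serre_adicImage_contains_congruenceSubgroup)
    (hU1 : ∀ (W : WeierstrassCurve ℚ) [W.IsElliptic] [W.IsGloballyMinimal], ¬ W.HasCM → (Literature.NumberTheory.EllipticCurves.Rank1Residual.GoodOrd W 2 ∨ Literature.NumberTheory.EllipticCurves.Rank1Residual.Mult W 2) → ¬ (∀ m : ℕ, W.HasSurjectiveModNGaloisRep (2 ^ m : ℕ)) → AddSubgroup.torsionBy W.toAffine.Point (2 : ℤ) = ⊥ → ∀ (K : Type) [Field K] [NumberField K], Literature.NumberTheory.EllipticCurves.IsImaginaryQuadratic K → ∀ [NeZero (W.conductorNorm ℤ)], Literature.NumberTheory.EllipticCurves.SatisfiesHeegnerHypothesis (W.conductorNorm ℤ) K → Odd (NumberField.discr K) → NumberField.discr K ≠ -3 → AddSubgroup.torsionBy (W.baseChange K).toAffine.Point (2 : ℤ) = ⊥ → Literature.NumberTheory.EllipticCurves.SatisfiesHeegnerHypothesis 2 K → ∀ (Dt : Literature.NumberTheory.EllipticCurves.ModularForms.ModularParametrizationData W (W.conductorNorm ℤ)) (β : ℤ) (ι : K →+* ℂ), (4 * (W.conductorNorm ℤ : ℤ))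 ∣ β ^ 2 - NumberField.discr K → ∃ r m : ℕ, ∀ M : ℕ, m < M → ∃ (n : ℕ) (d : Literature.NumberTheory.EllipticCurves.KolyvaginHeegnerData Dt β ι n), Literature.NumberTheory.EllipticCurves.KolyvaginDescent.KolSupp (Literature.NumberTheory.EllipticCurves.Zhang2014.IsKolyvaginPrime (W.conductorNorm ℤ) W K 2) n ∧ n.primeFactors.card = r ∧ ((M : ℕ) : ℕ∞) ≤ Literature.NumberTheory.EllipticCurves.Zhang2014.levelIndex W 2 n ∧ (2 ^ (M - m - 1) : ℤ) • d.kolyvaginClass Nat.prime_two M ≠ 0) :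
    ∀ (W : WeierstrassCurve ℚ) [W.IsElliptic] [W.IsGloballyMinimal], ¬ W.HasCM → (Literature.NumberTheory.EllipticCurves.Rank1Residual.GoodOrd W 2 ∨ Literature.NumberTheory.EllipticCurves.Rank1Residual.Mult W 2) → ¬ (∀ m : ℕ, W.HasSurjectiveModNGaloisRep (2 ^ m : ℕ)) → AddSubgroup.torsionBy W.toAffine.Point (2 : ℤ) = ⊥ → ∀ (K : Type) [Field K] [NumberField K], Literature.NumberTheory.EllipticCurves.IsImaginaryQuadratic K → ∀ [NeZero (W.conductorNorm ℤ)], Literature.NumberTheory.EllipticCurves.SatisfiesHeegnerHypothesis (W.conductorNorm ℤ) K → Odd (NumberField.discr K) → NumberField.discr K ≠ -3 → AddSubgroup.torsionBy (W.baseChange K).toAffine.Point (2 : ℤ) = ⊥ → Literature.NumberTheory.EllipticCurves.SatisfiesHeegnerHypothesis 2 K → ∀ (Dt : Literature.NumberTheory.EllipticCurves.ModularForms.ModularParametrizationData W (W.conductorNorm ℤ)) (β : ℤ) (ι : K →+* ℂ), (4 * (W.conductorNorm ℤ : ℤ)) ∣ β ^ 2 - NumberField.discr K → ∃ r : ℕ,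 ∀ θ k : ℕ, ∃ (n : ℕ) (d : Literature.NumberTheory.EllipticCurves.KolyvaginHeegnerData Dt β ι n) (M : ℕ), Literature.NumberTheory.EllipticCurves.KolyvaginDescent.KolSupp (Literature.NumberTheory.EllipticCurves.Zhang2014.IsKolyvaginPrime (W.conductorNorm ℤ) W K 2) n ∧ n.primeFactors.card = r ∧ 1 ≤ M ∧ ((θ * M + k : ℕ) : ℕ∞) ≤ Literature.NumberTheory.EllipticCurves.Zhang2014.levelIndex W 2 n ∧ d.kolyvaginClass Nat.prime_two M ≠ 0 := by
  intro W _ _ hCM hred hns htorQ K _ _ hK _ hHN hodd hne3 htor hH2 Dt β ι hβ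
  obtain ⟨c, hc⟩ :=
    fullClassDeepeningAtTwoIrr_of_prop37 h37 hSerre W hCM hred hns htorQ K hK hHN hodd hne3 htor hH2 Dt β ι hβ
  obtain ⟨r, m, hrm⟩ := hU1 W hCM hred hns htorQ K hK hHN hodd hne3 htor hH2 Dt β ι hβ
  refine ⟨r, fun θ k ↦ ?_⟩
  obtain ⟨n, d, hn, hr, hlev, hne⟩ := hrm (c * (m + r + 1) + m + 1) (by omega)
  exact hc θ k r m (c * (m + r + 1) + m + 1) n d hn hr hlev (by omega) hne

end Summit.BirchSwinnertonDyer.BirchSwinnertonDyer.Theorems.KolyvaginLowerBoundAtTwo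

end
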